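import Literature.NumberTheory.Transcendental.KZSemialgebraicComplex
import Literature.NumberTheory.Transcendental.KZPeriodsProofs
import Literature.NumberTheory.Transcendental.ZagierDilogarithmConjecture
import Mathlib.MeasureTheory.Integral.Pi
import Mathlib.Analysis.SpecialFunctions.ImproperIntegrals
import Mathlib.Analysis.SpecialFunctions.Integrability.Basic
import HarnessLib

/-!
# The ideal hyperbolic tetrahedron `T(∞, 0, 1, z)` as a Kontsevich–Zagier integral representation

In the upper half-space model `ℍ³ = {(x, y, t) | t > 0}` the hyperbolic volume element is
`dx dy dt / t³` (Milnor 1982, Appendix, proof of Lemma 2). The ideal tetrahedron with vertices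
`∞, 0, 1, z` (`Im z > 0`) is the region lying over the open Euclidean triangle with vertices
`0, 1, z` of the boundary plane `t = 0` and above the hemisphere through `0, 1, z` (the face
opposite to `∞`); seen from above it is that triangle (Zagier 1986, p. 299; Milnor 1982, loc. cit.).
Its volume is the Bloch–Wigner dilogarithm `D(z) = Л(α) + Л(β) + Л(γ)` (Milnor 1982, Lemma 2), a
fact NOT formalised here.

The solid itself, `idealTetrahedron z ⊆ ℝ³` (five polynomial inequalities in
`p = (p 0, p 1, p 2) = (x, y, t)` with coefficients in `ℤ[Re z, Im z]`; the hemisphere through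
`0, 1, z` is `Im z · (x² + y² + t² − x) + (Re z − |z|²) · y = 0`), and its volume
`idealTetrahedronVolume z = ∫_{T(z)} t⁻³` are the tree's
(`Literature/NumberTheory/Transcendental/ZagierDilogarithmConjecture.lean`; the set is
*syntactically* the `T z` quantified in the route files of the hyperbolic/Bloch sector). This file
proves what is needed to make it data of the KZ calculus (`KZCalculus.lean`):

* `isSemialgebraic_idealTetrahedron` — `T(z)` is `ℚ`-semialgebraic when `Re z`, `Im z` are
  algebraic (real algebraic parameters are `ℚ`-definable, `KZSemialgebraicComplex.lean`);
* `integrableOn_one_div_cube_idealTetrahedron` — **finite volume**: `t⁻³` is absolutely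
  integrable on `T(z)` whenever `Im z > 0` (no algebraicity needed); `idealTetrahedronVolume_pos`;
* `KZ.idealTetrahedronRep z hz him : KZ.IntegralRep 3` — the representation `[T(∞,0,1,z), t⁻³]`
  for `z` algebraic with `Im z > 0`, of KZ's literal rational shape (`p = 1`, `q = X₂³`), with
  `KZ.value_idealTetrahedronRep : value = idealTetrahedronVolume z` (`rfl`).

## The finiteness proof

We do not integrate fibrewise. Instead `t⁻³` is dominated on the solid by an integrable function
of product form (`KZ.UpperHalfSpace.integrableOn_one_div_cube_of_charts`, stated for any region of
`{t > 0}` over a bounded base admitting finitely many "cusp charts"): writing `λ₀, λ₁, λ₂` for the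
barycentric coordinates of `(x, y)` in the triangle `(0, 1, z)`, the power of `(x, y)` with respect
to the circumcircle is `−(λ₀λ₁ + |z|²λ₀λ₂ + |1 − z|²λ₁λ₂)`, so above the hemisphere
`t² > λ₀λ₁ + |z|²λ₀λ₂ + |1−z|²λ₁λ₂ ≥ κ · max(|x − vₓ|, |y − v_y|)` for the vertex `v` whose
barycentric coordinate is `≥ 1/3` (`κ = min(1, Im z)/3`); hence `t⁻³ ≤ κ^{-3/2}|x − vₓ|^{-3/4}
|y − v_y|^{-3/4}` there, and `|u|^{-3/4}` is integrable near `0`. Points with `t ≥ 1` are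
dominated by `t⁻³ 𝟙_{box}`.

## References

* J. Milnor, *Hyperbolic geometry: the first 150 years*, Bull. AMS 6 (1982), Appendix
  "Volume in hyperbolic 3-space", Lemma 2 and its proof (pp. 18–19).
* D. Zagier, *Hyperbolic manifolds and special values of Dedekind zeta functions*, Invent. Math.
  83 (1986), p. 299 (proof of Theorem 3).
* M. Kontsevich, D. Zagier, *Periods* (2001), §1.1 (algebraic parameters), §3.3.

## Design notes

* No new copy of the solid: `idealTetrahedron` / `idealTetrahedronVolume` of
  `ZagierDilogarithmConjecture.lean` are reused, so that Zagier's conjecture and the route items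
  (`T z`, `ρ z`) meet on one object.
* The representation needs `IsAlgebraic ℚ z` (for `ℚ`-semialgebraicity) and `0 < Im z`.
* The identification `idealTetrahedronVolume z = D(z)` (Milnor) and the Poincaré-extension change
  of variables are deliberately not here (they are route items).
-/

noncomputable section

open Set MeasureTheory MvPolynomial
open Literature.ModelTheory.ExponentialFields

namespace Literature.NumberTheory.Transcendental

namespace KZ

/-! ### Integrability of `t⁻³` on cusped regions of the upper half-space -/

namespace UpperHalfSpace

/-- `x ↦ |x| ^ r` is interval-integrable on every bounded interval when `-1 < r` (from Mathlib's
`intervalIntegrable_rpow'` on `[0, c]` and the reflection `x ↦ -x`). [folklore] -/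
theorem intervalIntegrable_abs_rpow {r : ℝ} (hr : -1 < r) (a b : ℝ) :
    IntervalIntegrable (fun x : ℝ => |x| ^ r) volume a b := by
  have hpos : ∀ c : ℝ, 0 ≤ c → IntervalIntegrable (fun x : ℝ => |x| ^ r) volume 0 c := by
    intro c hc
    refine (intervalIntegral.intervalIntegrable_rpow' hr (a := 0) (b := c)).congr ?_
    intro x hx
    rw [uIoc_of_le hc] at hx
    simp [abs_of_pos hx.1]
  have hall : ∀ c : ℝ, IntervalIntegrable (fun x : ℝ => |x| ^ r) volume 0 c := by
    intro c
    rcases le_total 0 c with hc | hc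
    · exact hpos c hc
    · have h := hpos (-c) (neg_nonneg.mpr hc)
      rw [IntervalIntegrable.iff_comp_neg] at h
      simpa [abs_neg] using h
  exact (hall a).symm.trans (hall b)

/-- `x ↦ |x - c| ^ r` is interval-integrable on every bounded interval when `-1 < r`. [folklore] -/
theorem intervalIntegrable_abs_sub_rpow {r : ℝ} (hr : -1 < r) (c a b : ℝ) :
    IntervalIntegrable (fun x : ℝ => |x - c| ^ r) volume a b := by
  have h := (intervalIntegrable_abs_rpow hr (a - c) (b - c)).comp_sub_right c
  simpa using h

/-- The cusp profile `x ↦ 𝟙_{[-M, M]}(x) · (κ |x - c|) ^ (-3/4)` is integrable on `ℝ`. [folklore] -/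
theorem integrable_indicator_cusp (M κ c : ℝ) (hκ : 0 ≤ κ) :
    Integrable (fun x : ℝ =>
      (Icc (-M) M).indicator (fun x => (κ * |x - c|) ^ (-(3 / 4 : ℝ))) x) := by
  refine (IntegrableOn.integrable_indicator ?_ measurableSet_Icc)
  rcases le_or_gt (-M) M with hM | hM
  · have h := ((intervalIntegrable_abs_sub_rpow (by norm_num : (-1 : ℝ) < -(3 / 4)) c (-M) M)
      |>.const_mul (κ ^ (-(3 / 4 : ℝ))))
    rw [intervalIntegrable_iff_integrableOn_Icc_of_le hM] at h
    refine h.congr_fun (fun x _ => ?_) measurableSet_Icc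
    simp only
    rw [Real.mul_rpow hκ (abs_nonneg _)]
  · rw [Icc_eq_empty (not_le.mpr hM)]
    exact integrableOn_empty

/-- The tail profile `t ↦ 𝟙_{[1, ∞)}(t) · t ^ (-3)` is integrable on `ℝ`. [folklore] -/
theorem integrable_indicator_rpow_neg_three :
    Integrable (fun t : ℝ => (Ici 1).indicator (fun t => t ^ (-(3 : ℝ))) t) := by
  refine IntegrableOn.integrable_indicator ?_ measurableSet_Ici
  rw [integrableOn_Ici_iff_integrableOn_Ioi]
  exact integrableOn_Ioi_rpow_of_lt (by norm_num) zero_lt_one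

/-- Indicators of bounded intervals are integrable on `ℝ`. [folklore] -/
theorem integrable_indicator_one_Icc (a b : ℝ) :
    Integrable (fun x : ℝ => (Icc a b).indicator (fun _ => (1 : ℝ)) x) :=
  IntegrableOn.integrable_indicator
    (integrableOn_const (measure_Icc_lt_top (a := a) (b := b)).ne) measurableSet_Icc

/-- Indicators of bounded open intervals are integrable on `ℝ`. [folklore] -/
theorem integrable_indicator_one_Ioo (a b : ℝ) :
    Integrable (fun x : ℝ => (Ioo a b).indicator (fun _ => (1 : ℝ)) x) :=
  IntegrableOn.integrable_indicator
    (integrableOn_const (measure_Ioo_lt_top (a := a) (b := b)).ne) measurableSet_Ioo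

/-- A product `f (p 0) * g (p 1) * h (p 2)` of integrable functions of one real variable each is
integrable on `ℝ³ = Fin 3 → ℝ` (Mathlib's `Integrable.fintype_prod`). [folklore] -/
theorem integrable_mul_mul_apply {f g h : ℝ → ℝ} (hf : Integrable f) (hg : Integrable g)
    (hh : Integrable h) :
    Integrable (fun p : Fin 3 → ℝ => f (p 0) * g (p 1) * h (p 2)) := by
  have H := Integrable.fintype_prod (μ := fun _ : Fin 3 => (volume : Measure ℝ))
    (f := ![f, g, h]) (by
      intro i
      fin_cases i
      · simpa using hf
      · simpa using hg
      · simpa using hh)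
  simpa [Fin.prod_univ_three, volume_pi] using H

/-- The elementary inequality behind the cusp estimate: if `0 < A, B ≤ t²` then
`t⁻³ ≤ A^{-3/4} B^{-3/4}`. [folklore] -/
theorem one_div_cube_le {A B t : ℝ} (hA : 0 < A) (hB : 0 < B) (ht : 0 < t) (hAt : A ≤ t ^ 2)
    (hBt : B ≤ t ^ 2) :
    1 / t ^ 3 ≤ A ^ (-(3 / 4 : ℝ)) * B ^ (-(3 / 4 : ℝ)) := by
  have hAB : A * B ≤ t ^ 4 := by nlinarith [mul_le_mul hAt hBt hB.le (sq_nonneg t)]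
  have h1 : (A * B) ^ (3 / 4 : ℝ) ≤ (t ^ 4) ^ (3 / 4 : ℝ) :=
    Real.rpow_le_rpow (by positivity) hAB (by norm_num)
  have h2 : ((t ^ 4 : ℝ)) ^ (3 / 4 : ℝ) = t ^ 3 := by
    rw [show (t ^ 4 : ℝ) = t ^ (4 : ℝ) by norm_cast, ← Real.rpow_mul ht.le]
    norm_num
  calc 1 / t ^ 3 = (t ^ 3)⁻¹ := one_div _
    _ ≤ ((A * B) ^ (3 / 4 : ℝ))⁻¹ := inv_anti₀ (by positivity) (h2 ▸ h1)
    _ = (A * B) ^ (-(3 / 4 : ℝ)) := (Real.rpow_neg (by positivity) _).symm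
    _ = A ^ (-(3 / 4 : ℝ)) * B ^ (-(3 / 4 : ℝ)) := Real.mul_rpow hA.le hB.le

/-- **Finite hyperbolic volume from cusp charts.** Let `T ⊆ ℝ³` be measurable, contained in
`{|x| ≤ M, |y| ≤ M, t > 0}`, and suppose that every point `(x, y, t) ∈ T` with `t < 1` satisfies
`κ |x - v₁| ≤ t²` and `κ |y - v₂| ≤ t²` for some `v` in a fixed finite set of base points (the
cusps on the boundary plane) and a fixed `κ > 0`. Then the hyperbolic volume density `t⁻³` of the
upper half-space model is absolutely integrable on `T`: it is dominated, off the null hyperplanes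
`x = v₁`, `y = v₂`, by `Σ_v (κ|x - v₁|)^{-3/4} (κ|y - v₂|)^{-3/4} 𝟙_{t < 1} + t^{-3} 𝟙_{t ≥ 1}`
(times the indicator of the box), a finite sum of integrable functions of product form.
[folklore] -/
theorem integrableOn_one_div_cube_of_charts {T : Set (Fin 3 → ℝ)} (hT : MeasurableSet T)
    {M κ : ℝ} (hκ : 0 < κ) (V : Finset (ℝ × ℝ))
    (hbox : ∀ p ∈ T, |p 0| ≤ M ∧ |p 1| ≤ M ∧ 0 < p 2)
    (hchart : ∀ p ∈ T, p 2 < 1 →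
      ∃ v ∈ V, κ * |p 0 - v.1| ≤ p 2 ^ 2 ∧ κ * |p 1 - v.2| ≤ p 2 ^ 2) :
    IntegrableOn (fun p : Fin 3 → ℝ => 1 / p 2 ^ 3) T := by
  -- the one-variable profiles
  set r : ℝ := -(3 / 4 : ℝ) with hr
  set gx : ℝ × ℝ → ℝ → ℝ := fun v x => (Icc (-M) M).indicator (fun x => (κ * |x - v.1|) ^ r) x
    with hgx
  set gy : ℝ × ℝ → ℝ → ℝ := fun v y => (Icc (-M) M).indicator (fun y => (κ * |y - v.2|) ^ r) y
    with hgy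
  set g2 : ℝ → ℝ := fun t => (Ioo 0 1).indicator (fun _ => (1 : ℝ)) t with hg2
  set h0 : ℝ → ℝ := fun x => (Icc (-M) M).indicator (fun _ => (1 : ℝ)) x with hh0
  set h2 : ℝ → ℝ := fun t => (Ici 1).indicator (fun t => t ^ (-(3 : ℝ))) t with hh2
  -- the dominating function
  set F : (Fin 3 → ℝ) → ℝ := fun p =>
    (∑ v ∈ V, gx v (p 0) * gy v (p 1) * g2 (p 2)) + h0 (p 0) * h0 (p 1) * h2 (p 2) with hF
  have hFint : Integrable F := by
    refine (integrable_finsetSum V fun v _ => ?_).add ?_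
    · exact integrable_mul_mul_apply (integrable_indicator_cusp M κ v.1 hκ.le)
        (integrable_indicator_cusp M κ v.2 hκ.le) (integrable_indicator_one_Ioo 0 1)
    · exact integrable_mul_mul_apply (integrable_indicator_one_Icc _ _)
        (integrable_indicator_one_Icc _ _) integrable_indicator_rpow_neg_three
  -- nonnegativity of the profiles
  have hgx0 : ∀ v x, 0 ≤ gx v x := fun v x => by
    simp only [hgx]
    exact Set.indicator_nonneg (fun _ _ => Real.rpow_nonneg (by positivity) _) _
  have hgy0 : ∀ v y, 0 ≤ gy v y := fun v y => by
    simp only [hgy]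
    exact Set.indicator_nonneg (fun _ _ => Real.rpow_nonneg (by positivity) _) _
  have hg20 : ∀ t, 0 ≤ g2 t := fun t => Set.indicator_nonneg (fun _ _ => zero_le_one) _
  have hh00 : ∀ x, 0 ≤ h0 x := fun x => Set.indicator_nonneg (fun _ _ => zero_le_one) _
  have hh20 : ∀ t, 0 < t → 0 ≤ h2 t := fun t ht =>
    Set.indicator_nonneg (fun _ _ => Real.rpow_nonneg ht.le _) _
  -- the exceptional null set
  set N : Set (Fin 3 → ℝ) := ⋃ v ∈ V, ({p | p 0 = v.1} ∪ {p | p 1 = v.2}) with hN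
  have hN0 : volume N = 0 := by
    refine (measure_biUnion_null_iff V.countable_toSet).mpr fun v _ => measure_union_null ?_ ?_
    · rw [volume_pi]
      exact Measure.pi_hyperplane (fun _ : Fin 3 => (volume : Measure ℝ)) (0 : Fin 3) v.1
    · rw [volume_pi]
      exact Measure.pi_hyperplane (fun _ : Fin 3 => (volume : Measure ℝ)) (1 : Fin 3) v.2
  have hae : ∀ᵐ p ∂(volume : Measure (Fin 3 → ℝ)), p ∉ N := compl_mem_ae_iff.mpr hN0
  -- measurability of the integrand
  have hmeas : AEStronglyMeasurable (fun p : Fin 3 → ℝ => 1 / p 2 ^ 3) (volume.restrict T) := by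
    refine Measurable.aestronglyMeasurable ?_
    exact (measurable_const.div ((measurable_pi_apply 2).pow_const 3))
  refine Integrable.mono' hFint.integrableOn hmeas ?_
  rw [ae_restrict_iff' hT]
  filter_upwards [hae] with p hpN hpT
  obtain ⟨hx, hy, ht⟩ := hbox p hpT
  have hnorm : ‖(1 : ℝ) / p 2 ^ 3‖ = 1 / p 2 ^ 3 := by
    rw [Real.norm_eq_abs, abs_of_pos (by positivity)]
  rw [hnorm]
  have hsum0 : 0 ≤ ∑ v ∈ V, gx v (p 0) * gy v (p 1) * g2 (p 2) :=
    Finset.sum_nonneg fun v _ => mul_nonneg (mul_nonneg (hgx0 v _) (hgy0 v _)) (hg20 _)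
  have hxM : p 0 ∈ Icc (-M) M := abs_le.mp hx
  have hyM : p 1 ∈ Icc (-M) M := abs_le.mp hy
  rcases le_or_gt 1 (p 2) with ht1 | ht1
  · -- the tail `t ≥ 1`
    have htail : h0 (p 0) * h0 (p 1) * h2 (p 2) = 1 / p 2 ^ 3 := by
      simp only [hh0, hh2, Set.indicator_of_mem hxM, Set.indicator_of_mem hyM,
        Set.indicator_of_mem (show p 2 ∈ Ici (1 : ℝ) from ht1), one_mul]
      rw [Real.rpow_neg ht.le, show (3 : ℝ) = ((3 : ℕ) : ℝ) by norm_num, Real.rpow_natCast,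
        one_div]
    calc 1 / p 2 ^ 3 = h0 (p 0) * h0 (p 1) * h2 (p 2) := htail.symm
      _ ≤ F p := le_add_of_nonneg_left hsum0
  · -- the cusps `t < 1`
    obtain ⟨v, hvV, hvx, hvy⟩ := hchart p hpT ht1
    have hx0 : p 0 ≠ v.1 := fun h => hpN (mem_biUnion hvV (Or.inl h))
    have hy0 : p 1 ≠ v.2 := fun h => hpN (mem_biUnion hvV (Or.inr h))
    have hA : 0 < κ * |p 0 - v.1| := mul_pos hκ (abs_pos.mpr (sub_ne_zero.mpr hx0))
    have hB : 0 < κ * |p 1 - v.2| := mul_pos hκ (abs_pos.mpr (sub_ne_zero.mpr hy0))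
    have hterm : gx v (p 0) * gy v (p 1) * g2 (p 2) =
        (κ * |p 0 - v.1|) ^ r * (κ * |p 1 - v.2|) ^ r := by
      simp only [hgx, hgy, hg2, Set.indicator_of_mem hxM, Set.indicator_of_mem hyM,
        Set.indicator_of_mem (show p 2 ∈ Ioo (0 : ℝ) 1 from ⟨ht, ht1⟩), mul_one]
    calc 1 / p 2 ^ 3 ≤ (κ * |p 0 - v.1|) ^ r * (κ * |p 1 - v.2|) ^ r :=
          one_div_cube_le hA hB ht hvx hvy
      _ = gx v (p 0) * gy v (p 1) * g2 (p 2) := hterm.symm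
      _ ≤ ∑ w ∈ V, gx w (p 0) * gy w (p 1) * g2 (p 2) :=
          Finset.single_le_sum (f := fun w => gx w (p 0) * gy w (p 1) * g2 (p 2))
            (fun w _ => mul_nonneg (mul_nonneg (hgx0 w _) (hgy0 w _)) (hg20 _)) hvV
      _ ≤ F p := le_add_of_nonneg_right
          (mul_nonneg (mul_nonneg (hh00 _) (hh00 _)) (hh20 _ ht))

end UpperHalfSpace

end KZ

/-! ### The solid ideal tetrahedron `idealTetrahedron z` over the triangle `(0, 1, z)` -/

/-- The ideal tetrahedron as the intersection of its five defining half-spaces / sphere exterior.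
[cite: Milnor1982, Appendix, Lemma 2 (proof)] -/
theorem idealTetrahedron_eq_inter (z : ℂ) :
    idealTetrahedron z = {p : Fin 3 → ℝ | 0 < p 1} ∩
      ({p : Fin 3 → ℝ | z.re * p 1 < z.im * p 0} ∩
        ({p : Fin 3 → ℝ | z.im * (p 0 - 1) < (z.re - 1) * p 1} ∩ ({p : Fin 3 → ℝ | 0 < p 2} ∩
          {p : Fin 3 → ℝ |
            0 < z.im * (p 0 ^ 2 + p 1 ^ 2 + p 2 ^ 2 - p 0) + (z.re - Complex.normSq z) * p 1}))) :=
  Set.ext fun _ => Iff.rfl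

/-- The ideal tetrahedron is an open subset of `ℝ³` (five strict polynomial inequalities).
[cite: Milnor1982, Appendix, Lemma 2 (proof)] -/
theorem isOpen_idealTetrahedron (z : ℂ) : IsOpen (idealTetrahedron z) := by
  rw [idealTetrahedron_eq_inter]
  refine (isOpen_lt ?_ ?_).inter ((isOpen_lt ?_ ?_).inter ((isOpen_lt ?_ ?_).inter
    ((isOpen_lt ?_ ?_).inter (isOpen_lt ?_ ?_)))) <;> fun_prop

/-- The ideal tetrahedron is Lebesgue measurable. [cite: Milnor1982, Appendix, Lemma 2 (proof)] -/
theorem measurableSet_idealTetrahedron (z : ℂ) :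
    MeasurableSet (idealTetrahedron z) :=
  (isOpen_idealTetrahedron z).measurableSet

/-- The ideal tetrahedron is non-empty when `Im z > 0`: it contains the point over the centroid of
the triangle at height `t = 1 + |z|²`. [cite: Milnor1982, Appendix, Lemma 2 (proof)] -/
theorem nonempty_idealTetrahedron {z : ℂ} (him : 0 < z.im) :
    (idealTetrahedron z).Nonempty := by
  have hN : Complex.normSq z = z.re * z.re + z.im * z.im := Complex.normSq_apply z
  refine ⟨![(1 + z.re) / 3, z.im / 3, 1 + Complex.normSq z], ?_⟩
  simp only [mem_idealTetrahedron_iff, Matrix.cons_val_zero, Matrix.cons_val_one,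
    Matrix.cons_val]
  have hN0 : 0 ≤ Complex.normSq z := Complex.normSq_nonneg z
  refine ⟨by positivity, by nlinarith, by nlinarith, by linarith, ?_⟩
  have key : z.im * (((1 + z.re) / 3) ^ 2 + (z.im / 3) ^ 2 + (1 + Complex.normSq z) ^ 2 -
      (1 + z.re) / 3) + (z.re - Complex.normSq z) * (z.im / 3) =
      z.im * ((1 + Complex.normSq z) ^ 2 + 2 / 9 * (z.re - 1 - Complex.normSq z)) := by
    rw [hN]; ring
  rw [key]
  refine mul_pos him ?_
  rw [hN]
  nlinarith [sq_nonneg (16 * z.re + 1), sq_nonneg z.im, sq_nonneg (z.re * z.re + z.im * z.im),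
    sq_nonneg z.re]

/-! ### `ℚ`-semialgebraicity for algebraic `z` -/

/-- Strict inequalities between real `ℚ`-semialgebraic functions cut out `ℚ`-semialgebraic sets
(graph elimination, Tarski–Seidenberg). [cite: BochnakCosteRoy1998, Prop. 2.2.6] -/
theorem isSemialgebraic_setOf_lt_of_isSemialgebraicFunOn {m : ℕ} {u v : (Fin m → ℝ) → ℝ}
    (hu : IsSemialgebraicFunOn ℚ (univ : Set (Fin m → ℝ)) u)
    (hv : IsSemialgebraicFunOn ℚ (univ : Set (Fin m → ℝ)) v) :
    IsSemialgebraic ℚ {p | u p < v p} := by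
  have h := (IsSemialgebraicFunOn.sub_holds hu hv).isSemialgebraic_sep_neg
  convert h using 1
  ext p
  simp [sub_neg]

/-- **The ideal tetrahedron is `ℚ`-semialgebraic** when `Re z` and `Im z` are algebraic: its five
defining inequalities compare polynomials in `x, y, t` whose coefficients are polynomials in the
real algebraic numbers `Re z`, `Im z`, and real algebraic constants are `ℚ`-definable
(`isSemialgebraicFunOn_const_of_isAlgebraic`; Kontsevich–Zagier allow algebraic in place of
rational coefficients). [cite: KontsevichZagier2001, §1.1] -/
theorem isSemialgebraic_idealTetrahedron {z : ℂ} (hre : IsAlgebraic ℚ z.re)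
    (him : IsAlgebraic ℚ z.im) : IsSemialgebraic ℚ (idealTetrahedron z) := by
  have hU : IsSemialgebraic ℚ (univ : Set (Fin 3 → ℝ)) := isSemialgebraic_univ
  -- the building blocks: coordinates, algebraic constants, a rational polynomial
  have hc : ∀ i : Fin 3, IsSemialgebraicFunOn ℚ (univ : Set (Fin 3 → ℝ)) (fun p => p i) :=
    fun i => (isSemialgebraicFunOn_aeval hU (X i)).congr fun p _ => by simp
  have ha : IsSemialgebraicFunOn ℚ (univ : Set (Fin 3 → ℝ)) (fun _ => z.re) :=
    isSemialgebraicFunOn_const_of_isAlgebraic hU hre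
  have hb : IsSemialgebraicFunOn ℚ (univ : Set (Fin 3 → ℝ)) (fun _ => z.im) :=
    isSemialgebraicFunOn_const_of_isAlgebraic hU him
  have hN : IsSemialgebraicFunOn ℚ (univ : Set (Fin 3 → ℝ)) (fun _ => Complex.normSq z) := by
    have h : IsAlgebraic ℚ (Complex.normSq z) := by
      rw [Complex.normSq_apply]
      exact (hre.mul hre).add (him.mul him)
    exact isSemialgebraicFunOn_const_of_isAlgebraic hU h
  have h0 : IsSemialgebraicFunOn ℚ (univ : Set (Fin 3 → ℝ)) (fun _ => (0 : ℝ)) := by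
    simpa using isSemialgebraicFunOn_natCast (k := ℚ) (R := ℝ) hU 0
  have h1 : IsSemialgebraicFunOn ℚ (univ : Set (Fin 3 → ℝ)) (fun _ => (1 : ℝ)) := by
    simpa using isSemialgebraicFunOn_natCast (k := ℚ) (R := ℝ) hU 1
  have hP : IsSemialgebraicFunOn ℚ (univ : Set (Fin 3 → ℝ))
      (fun p => p 0 ^ 2 + p 1 ^ 2 + p 2 ^ 2 - p 0) :=
    (isSemialgebraicFunOn_aeval hU (X 0 ^ 2 + X 1 ^ 2 + X 2 ^ 2 - X 0)).congr fun p _ => by simp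
  -- the five pieces
  have S1 : IsSemialgebraic ℚ {p : Fin 3 → ℝ | 0 < p 1} :=
    isSemialgebraic_setOf_lt_of_isSemialgebraicFunOn h0 (hc 1)
  have S2 : IsSemialgebraic ℚ {p : Fin 3 → ℝ | z.re * p 1 < z.im * p 0} :=
    isSemialgebraic_setOf_lt_of_isSemialgebraicFunOn (IsSemialgebraicFunOn.mul_holds ha (hc 1))
      (IsSemialgebraicFunOn.mul_holds hb (hc 0))
  have S3 : IsSemialgebraic ℚ {p : Fin 3 → ℝ | z.im * (p 0 - 1) < (z.re - 1) * p 1} :=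
    isSemialgebraic_setOf_lt_of_isSemialgebraicFunOn
      (IsSemialgebraicFunOn.mul_holds hb (IsSemialgebraicFunOn.sub_holds (hc 0) h1))
      (IsSemialgebraicFunOn.mul_holds (IsSemialgebraicFunOn.sub_holds ha h1) (hc 1))
  have S4 : IsSemialgebraic ℚ {p : Fin 3 → ℝ | 0 < p 2} :=
    isSemialgebraic_setOf_lt_of_isSemialgebraicFunOn h0 (hc 2)
  have S5 : IsSemialgebraic ℚ {p : Fin 3 → ℝ |
      0 < z.im * (p 0 ^ 2 + p 1 ^ 2 + p 2 ^ 2 - p 0) + (z.re - Complex.normSq z) * p 1} :=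
    isSemialgebraic_setOf_lt_of_isSemialgebraicFunOn h0
      (IsSemialgebraicFunOn.add_holds (IsSemialgebraicFunOn.mul_holds hb hP)
        (IsSemialgebraicFunOn.mul_holds (IsSemialgebraicFunOn.sub_holds ha hN) (hc 1)))
  rw [idealTetrahedron_eq_inter]
  exact S1.inter (S2.inter (S3.inter (S4.inter S5)))

/-- The hyperbolic volume density `t⁻³ = 1 / X₂³` is a `ℚ`-semialgebraic function on any
`ℚ`-semialgebraic subset of the open upper half-space (a quotient of rational polynomials with
non-vanishing denominator). [cite: KontsevichZagier2001, §1.1] -/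
theorem isSemialgebraicFunOn_one_div_cube {s : Set (Fin 3 → ℝ)} (hs : IsSemialgebraic ℚ s)
    (h : s ⊆ {p | 0 < p 2}) : IsSemialgebraicFunOn ℚ s (fun p : Fin 3 → ℝ => 1 / p 2 ^ 3) := by
  have hq : ∀ p ∈ s, aeval p (X 2 ^ 3 : MvPolynomial (Fin 3) ℚ) ≠ 0 := fun p hp => by
    have h2 : (0 : ℝ) < p 2 := h hp
    simpa using pow_ne_zero 3 h2.ne'
  exact (isSemialgebraicFunOn_aeval_div_aeval hs 1 (X 2 ^ 3) hq).congr fun p _ => by simp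

/-! ### Finite volume: the cusp charts of the ideal tetrahedron -/

/-- Cusp chart at a vertex of the base triangle, in scaled barycentric coordinates `L₀, L₁, L₂`
(pure real-arithmetic core of `idealTetrahedron_charts`): if the coordinate `L₀` of the vertex
is `≥ b/3` then `b² κ X` and `b² κ L₂` are bounded by the barycentric form
`L₀ L₁ + N L₀ L₂ + N' L₁ L₂`, where `b X ≤ L₁ + |a| L₂` (`X` the horizontal distance to the vertex).
[folklore] -/
theorem idealTetrahedron_charts_aux_vertex {a b κ L0 L1 L2 N N' X : ℝ} (hb : 0 < b)
    (hL0 : 0 < L0) (hL1 : 0 < L1) (hL2 : 0 < L2) (hN'0 : 0 ≤ N') (hNb : b ^ 2 ≤ N)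
    (hNa : b * |a| ≤ N)
    (hκ0 : 0 < κ) (hκ1 : κ ≤ 1 / 3) (hκb : κ ≤ b / 3) (hA : b / 3 ≤ L0)
    (hX : b * X ≤ L1 + |a| * L2) :
    b ^ 2 * (κ * X) ≤ L0 * L1 + N * L0 * L2 + N' * L1 * L2 ∧
      b ^ 2 * (κ * L2) ≤ L0 * L1 + N * L0 * L2 + N' * L1 * L2 := by
  have hN0 : 0 ≤ N := le_trans (by positivity) hNb
  have hbk : b * κ ≤ b / 3 := by
    have := mul_le_mul_of_nonneg_left hκ1 hb.le; linarith
  have hrest : 0 ≤ N' * L1 * L2 := by positivity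
  constructor
  · have t1 : b * κ * L1 ≤ L0 * L1 := mul_le_mul_of_nonneg_right (hbk.trans hA) hL1.le
    have hka : κ * |a| ≤ N / 3 := by
      have := mul_le_mul_of_nonneg_right hκb (abs_nonneg a); nlinarith
    have t2 : b * κ * (|a| * L2) ≤ N * L0 * L2 :=
      calc b * κ * (|a| * L2) = (κ * |a|) * (b * L2) := by ring
        _ ≤ (N / 3) * (b * L2) := mul_le_mul_of_nonneg_right hka (by positivity)
        _ = N * (b / 3) * L2 := by ring
        _ ≤ N * L0 * L2 := by gcongr
    calc b ^ 2 * (κ * X) = b * κ * (b * X) := by ring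
      _ ≤ b * κ * (L1 + |a| * L2) := mul_le_mul_of_nonneg_left hX (by positivity)
      _ = b * κ * L1 + b * κ * (|a| * L2) := by ring
      _ ≤ L0 * L1 + N * L0 * L2 + N' * L1 * L2 := by linarith
  · have hL : 0 ≤ L0 * L1 := by positivity
    calc b ^ 2 * (κ * L2) = b ^ 2 * κ * L2 := by ring
      _ ≤ b ^ 2 * (b / 3) * L2 := by gcongr
      _ ≤ N * L0 * L2 := by gcongr
      _ ≤ L0 * L1 + N * L0 * L2 + N' * L1 * L2 := by linarith

/-- Cusp chart at the third vertex `z` (coordinate `L₂ ≥ b/3`): here `b X ≤ |a| L₀ + |a − 1| L₁`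
and the vertical distance is `L₀ + L₁`. [folklore] -/
theorem idealTetrahedron_charts_aux_apex {a b κ L0 L1 L2 N N' X : ℝ} (hb : 0 < b)
    (hL0 : 0 < L0) (hL1 : 0 < L1) (hNb : b ^ 2 ≤ N) (hN'b : b ^ 2 ≤ N') (hNa : b * |a| ≤ N)
    (hN'a : b * |a - 1| ≤ N')
    (hκ0 : 0 < κ) (hκb : κ ≤ b / 3) (hC : b / 3 ≤ L2)
    (hX : b * X ≤ |a| * L0 + |a - 1| * L1) :
    b ^ 2 * (κ * X) ≤ L0 * L1 + N * L0 * L2 + N' * L1 * L2 ∧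
      b ^ 2 * (κ * (L0 + L1)) ≤ L0 * L1 + N * L0 * L2 + N' * L1 * L2 := by
  have hN0 : 0 ≤ N := le_trans (by positivity) hNb
  have hN'0 : 0 ≤ N' := le_trans (by positivity) hN'b
  have hL : 0 ≤ L0 * L1 := by positivity
  have hL2 : 0 ≤ L2 := le_trans (by positivity) hC
  constructor
  · have hka : κ * |a| ≤ N / 3 := by
      have := mul_le_mul_of_nonneg_right hκb (abs_nonneg a); nlinarith
    have hka' : κ * |a - 1| ≤ N' / 3 := by
      have := mul_le_mul_of_nonneg_right hκb (abs_nonneg (a - 1)); nlinarith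
    have t1 : b * κ * (|a| * L0) ≤ N * L0 * L2 :=
      calc b * κ * (|a| * L0) = (κ * |a|) * (b * L0) := by ring
        _ ≤ (N / 3) * (b * L0) := mul_le_mul_of_nonneg_right hka (by positivity)
        _ = N * L0 * (b / 3) := by ring
        _ ≤ N * L0 * L2 := by gcongr
    have t2 : b * κ * (|a - 1| * L1) ≤ N' * L1 * L2 :=
      calc b * κ * (|a - 1| * L1) = (κ * |a - 1|) * (b * L1) := by ring
        _ ≤ (N' / 3) * (b * L1) := mul_le_mul_of_nonneg_right hka' (by positivity)
        _ = N' * L1 * (b / 3) := by ring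
        _ ≤ N' * L1 * L2 := by gcongr
    calc b ^ 2 * (κ * X) = b * κ * (b * X) := by ring
      _ ≤ b * κ * (|a| * L0 + |a - 1| * L1) := mul_le_mul_of_nonneg_left hX (by positivity)
      _ = b * κ * (|a| * L0) + b * κ * (|a - 1| * L1) := by ring
      _ ≤ L0 * L1 + N * L0 * L2 + N' * L1 * L2 := by linarith
  · have t1 : b ^ 2 * κ * L0 ≤ N * L0 * L2 :=
      calc b ^ 2 * κ * L0 ≤ b ^ 2 * (b / 3) * L0 := by gcongr
        _ ≤ N * L2 * L0 := by gcongr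
        _ = N * L0 * L2 := by ring
    have t2 : b ^ 2 * κ * L1 ≤ N' * L1 * L2 :=
      calc b ^ 2 * κ * L1 ≤ b ^ 2 * (b / 3) * L1 := by gcongr
        _ ≤ N' * L2 * L1 := by gcongr
        _ = N' * L1 * L2 := by ring
    calc b ^ 2 * (κ * (L0 + L1)) = b ^ 2 * κ * L0 + b ^ 2 * κ * L1 := by ring
      _ ≤ L0 * L1 + N * L0 * L2 + N' * L1 * L2 := by linarith

/-- **Cusp charts of the ideal tetrahedron.** For `Im z = b > 0`, every point `(x, y, t)` of
`T(∞, 0, 1, z)` satisfies `κ |x − v₁| ≤ t²` and `κ |y − v₂| ≤ t²` for one of the three finite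
vertices `v ∈ {(0, 0), (1, 0), (Re z, Im z)}`, with `κ = min (1, b) / 3`. Proof: in the scaled
barycentric coordinates `L₀ = b − b x + (a − 1) y`, `L₁ = b x − a y`, `L₂ = y` (`a = Re z`; all
positive on the triangle, `L₀ + L₁ + L₂ = b`) the hemisphere condition reads
`b² t² > L₀ L₁ + |z|² L₀ L₂ + |1 − z|² L₁ L₂` (the power of `(x, y)` with respect to the
circumcircle is `−Σ |vᵢ − vⱼ|² λᵢ λⱼ`), and the vertex with `Lᵢ ≥ b / 3` works.
[cite: Milnor1982, Appendix, Lemma 2 (proof)] -/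
theorem idealTetrahedron_charts {z : ℂ} (him : 0 < z.im) {p : Fin 3 → ℝ}
    (hp : p ∈ idealTetrahedron z) :
    ∃ v ∈ ({((0 : ℝ), (0 : ℝ)), (1, 0), (z.re, z.im)} : Finset (ℝ × ℝ)),
      min 1 z.im / 3 * |p 0 - v.1| ≤ p 2 ^ 2 ∧ min 1 z.im / 3 * |p 1 - v.2| ≤ p 2 ^ 2 := by
  obtain ⟨hy, h01, h1z, ht, hS⟩ := hp
  have hNsq : Complex.normSq z = z.re * z.re + z.im * z.im := Complex.normSq_apply z
  rw [hNsq] at hS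
  -- the constant
  have hκ1 : min 1 z.im / 3 ≤ 1 / 3 := by have := min_le_left 1 z.im; linarith
  have hκb : min 1 z.im / 3 ≤ z.im / 3 := by have := min_le_right 1 z.im; linarith
  have hκ0 : 0 < min 1 z.im / 3 := by have := lt_min one_pos him; positivity
  -- scaled barycentric coordinates and the barycentric form of the hemisphere condition
  have hL0 : 0 < z.im - z.im * p 0 + (z.re - 1) * p 1 := by linarith
  have hL1 : 0 < z.im * p 0 - z.re * p 1 := by linarith
  have hid : z.im * (z.im * (p 0 ^ 2 + p 1 ^ 2 + p 2 ^ 2 - p 0) +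
      (z.re - (z.re * z.re + z.im * z.im)) * p 1) = z.im ^ 2 * p 2 ^ 2 -
      ((z.im - z.im * p 0 + (z.re - 1) * p 1) * (z.im * p 0 - z.re * p 1) +
        (z.re ^ 2 + z.im ^ 2) * (z.im - z.im * p 0 + (z.re - 1) * p 1) * p 1 +
        ((z.re - 1) ^ 2 + z.im ^ 2) * (z.im * p 0 - z.re * p 1) * p 1) := by ring
  have hpow : (z.im - z.im * p 0 + (z.re - 1) * p 1) * (z.im * p 0 - z.re * p 1) +
      (z.re ^ 2 + z.im ^ 2) * (z.im - z.im * p 0 + (z.re - 1) * p 1) * p 1 +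
      ((z.re - 1) ^ 2 + z.im ^ 2) * (z.im * p 0 - z.re * p 1) * p 1 < z.im ^ 2 * p 2 ^ 2 := by
    have h := mul_pos him hS
    rw [hid] at h
    linarith
  have hNb : z.im ^ 2 ≤ z.re ^ 2 + z.im ^ 2 := by nlinarith [sq_nonneg z.re]
  have hN'b : z.im ^ 2 ≤ (z.re - 1) ^ 2 + z.im ^ 2 := by nlinarith [sq_nonneg (z.re - 1)]
  have hNa : z.im * |z.re| ≤ z.re ^ 2 + z.im ^ 2 := by
    rw [← sq_abs z.re]; nlinarith [sq_nonneg (|z.re| - z.im), abs_nonneg z.re]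
  have hN'a : z.im * |z.re - 1| ≤ (z.re - 1) ^ 2 + z.im ^ 2 := by
    rw [← sq_abs (z.re - 1)]; nlinarith [sq_nonneg (|z.re - 1| - z.im), abs_nonneg (z.re - 1)]
  have hb2 : 0 < z.im ^ 2 := by positivity
  -- it suffices to bound `b² κ |·|` by the barycentric form
  have key : ∀ {u : ℝ}, z.im ^ 2 * (min 1 z.im / 3 * u) ≤
      (z.im - z.im * p 0 + (z.re - 1) * p 1) * (z.im * p 0 - z.re * p 1) +
        (z.re ^ 2 + z.im ^ 2) * (z.im - z.im * p 0 + (z.re - 1) * p 1) * p 1 +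
        ((z.re - 1) ^ 2 + z.im ^ 2) * (z.im * p 0 - z.re * p 1) * p 1 →
      min 1 z.im / 3 * u ≤ p 2 ^ 2 :=
    fun h => le_of_mul_le_mul_left (h.trans hpow.le) hb2
  rcases le_or_gt (z.im / 3) (z.im - z.im * p 0 + (z.re - 1) * p 1) with hA | hA
  · -- near the vertex `0`
    have hX : z.im * |p 0 - 0| ≤ (z.im * p 0 - z.re * p 1) + |z.re| * p 1 := by
      have e : z.im * (p 0 - 0) = (z.im * p 0 - z.re * p 1) + z.re * p 1 := by ring
      calc z.im * |p 0 - 0| = |(z.im * p 0 - z.re * p 1) + z.re * p 1| := by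
            rw [← e, abs_mul, abs_of_pos him]
        _ ≤ |z.im * p 0 - z.re * p 1| + |z.re * p 1| := abs_add_le _ _
        _ = (z.im * p 0 - z.re * p 1) + |z.re| * p 1 := by
          rw [abs_of_pos hL1, abs_mul, abs_of_pos hy]
    obtain ⟨c1, c2⟩ := idealTetrahedron_charts_aux_vertex (N' := (z.re - 1) ^ 2 + z.im ^ 2) him
      hL0 hL1 hy (by positivity) hNb hNa hκ0 hκ1 hκb hA hX
    refine ⟨(0, 0), by simp, key c1, key ?_⟩
    simpa [abs_of_pos hy] using c2
  rcases le_or_gt (z.im / 3) (z.im * p 0 - z.re * p 1) with hB | hB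
  · -- near the vertex `1`: the same chart with the roles of `L₀`, `L₁` exchanged
    have hX : z.im * |p 0 - 1| ≤ (z.im - z.im * p 0 + (z.re - 1) * p 1) + |z.re - 1| * p 1 := by
      have e : z.im * (p 0 - 1) = (z.re - 1) * p 1 - (z.im - z.im * p 0 + (z.re - 1) * p 1) := by
        ring
      calc z.im * |p 0 - 1| = |(z.re - 1) * p 1 - (z.im - z.im * p 0 + (z.re - 1) * p 1)| := by
            rw [← e, abs_mul, abs_of_pos him]
        _ ≤ |(z.re - 1) * p 1| + |z.im - z.im * p 0 + (z.re - 1) * p 1| := abs_sub _ _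
        _ = (z.im - z.im * p 0 + (z.re - 1) * p 1) + |z.re - 1| * p 1 := by
          rw [abs_of_pos hL0, abs_mul, abs_of_pos hy]; ring
    obtain ⟨c1, c2⟩ := idealTetrahedron_charts_aux_vertex (N := (z.re - 1) ^ 2 + z.im ^ 2)
      (N' := z.re ^ 2 + z.im ^ 2) him hL1 hL0 hy (by positivity) hN'b hN'a hκ0 hκ1 hκb hB hX
    refine ⟨(1, 0), by simp, key (by linarith [c1]), key ?_⟩
    rw [sub_zero, abs_of_pos hy]
    linarith [c2]
  · -- near the vertex `z`: `L₂ = y ≥ b / 3` since `L₀ + L₁ + L₂ = b`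
    have hC : z.im / 3 ≤ p 1 := by linarith
    have hX : z.im * |p 0 - z.re| ≤ |z.re| * (z.im - z.im * p 0 + (z.re - 1) * p 1) +
        |z.re - 1| * (z.im * p 0 - z.re * p 1) := by
      have e : z.im * (p 0 - z.re) = (1 - z.re) * (z.im * p 0 - z.re * p 1) -
          z.re * (z.im - z.im * p 0 + (z.re - 1) * p 1) := by ring
      calc z.im * |p 0 - z.re|
          = |(1 - z.re) * (z.im * p 0 - z.re * p 1) -
              z.re * (z.im - z.im * p 0 + (z.re - 1) * p 1)| := by
            rw [← e, abs_mul, abs_of_pos him]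
        _ ≤ |(1 - z.re) * (z.im * p 0 - z.re * p 1)| +
              |z.re * (z.im - z.im * p 0 + (z.re - 1) * p 1)| := abs_sub _ _
        _ = |z.re| * (z.im - z.im * p 0 + (z.re - 1) * p 1) +
              |z.re - 1| * (z.im * p 0 - z.re * p 1) := by
          rw [abs_mul, abs_mul, abs_of_pos hL0, abs_of_pos hL1, abs_sub_comm 1 z.re]; ring
    obtain ⟨c1, c2⟩ := idealTetrahedron_charts_aux_apex him hL0 hL1 hNb hN'b hNa hN'a hκ0 hκb hC hX
    refine ⟨(z.re, z.im), by simp, key c1, key ?_⟩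
    have hyb : |p 1 - z.im| =
        (z.im - z.im * p 0 + (z.re - 1) * p 1) + (z.im * p 0 - z.re * p 1) := by
      rw [abs_sub_comm, abs_of_pos (by linarith)]; ring
    rw [hyb]
    exact c2

/-- The ideal tetrahedron lies over a bounded part of the boundary plane:
`|x|, |y| ≤ 2 + |Re z| + Im z`, and `t > 0`. [cite: Milnor1982, Appendix, Lemma 2 (proof)] -/
theorem idealTetrahedron_box {z : ℂ} (him : 0 < z.im) {p : Fin 3 → ℝ}
    (hp : p ∈ idealTetrahedron z) :
    |p 0| ≤ 2 + |z.re| + z.im ∧ |p 1| ≤ 2 + |z.re| + z.im ∧ 0 < p 2 := by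
  obtain ⟨hy, h01, h1z, ht, -⟩ := hp
  have hL0 : 0 < z.im - z.im * p 0 + (z.re - 1) * p 1 := by linarith
  have hyb : p 1 < z.im := by nlinarith
  have ha0 : 0 ≤ |z.re| := abs_nonneg _
  refine ⟨abs_le.mpr ⟨?_, ?_⟩, abs_le.mpr ⟨by linarith, by linarith⟩, ht⟩
  · -- lower bound: `b x > a y ≥ -|a| b`
    have h1 : -(|z.re| * z.im) ≤ z.re * p 1 :=
      calc -(|z.re| * z.im) ≤ -(|z.re| * p 1) := by
            have := mul_le_mul_of_nonneg_left hyb.le ha0; linarith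
        _ = -|z.re| * p 1 := by ring
        _ ≤ z.re * p 1 := mul_le_mul_of_nonneg_right (neg_abs_le z.re) hy.le
    have h2 : z.im * -(2 + |z.re| + z.im) < z.im * p 0 := by nlinarith
    exact (lt_of_mul_lt_mul_left h2 him.le).le
  · -- upper bound: `b x < b + (a - 1) y ≤ b + |a - 1| b`
    have h1 : (z.re - 1) * p 1 ≤ |z.re - 1| * z.im :=
      calc (z.re - 1) * p 1 ≤ |z.re - 1| * p 1 :=
            mul_le_mul_of_nonneg_right (le_abs_self _) hy.le
        _ ≤ |z.re - 1| * z.im := mul_le_mul_of_nonneg_left hyb.le (abs_nonneg _)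
    have h4 : |z.re - 1| ≤ |z.re| + 1 := by
      calc |z.re - 1| ≤ |z.re| + |(1 : ℝ)| := abs_sub _ _
        _ = |z.re| + 1 := by rw [abs_one]
    have h5 : |z.re - 1| * z.im ≤ (|z.re| + 1) * z.im := mul_le_mul_of_nonneg_right h4 him.le
    have h2 : z.im * p 0 < z.im * (2 + |z.re| + z.im) := by nlinarith [mul_pos him him]
    exact (lt_of_mul_lt_mul_left h2 him.le).le

/-- **Finite volume of the ideal tetrahedron.** For `Im z > 0` the hyperbolic volume density
`t⁻³` is absolutely integrable on `T(∞, 0, 1, z)` (Milnor: the volume is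
`Л(α) + Л(β) + Л(γ) < ∞`; here from the cusp charts `idealTetrahedron_charts` and
`KZ.UpperHalfSpace.integrableOn_one_div_cube_of_charts`). [cite: Milnor1982, Appendix, Lemma 2] -/
theorem integrableOn_one_div_cube_idealTetrahedron {z : ℂ} (him : 0 < z.im) :
    IntegrableOn (fun p : Fin 3 → ℝ => 1 / p 2 ^ 3) (idealTetrahedron z) := by
  have hκ : 0 < min 1 z.im / 3 := by have := lt_min one_pos him; positivity
  exact KZ.UpperHalfSpace.integrableOn_one_div_cube_of_charts (measurableSet_idealTetrahedron z)
    (M := 2 + |z.re| + z.im) hκ ({((0 : ℝ), (0 : ℝ)), (1, 0), (z.re, z.im)} : Finset (ℝ × ℝ))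
    (fun p hp => idealTetrahedron_box him hp)
    (fun p hp _ => idealTetrahedron_charts him hp)

/-- **The ideal tetrahedron has positive, finite hyperbolic volume**: for `Im z > 0`,
`0 < idealTetrahedronVolume z = ∫_{T(z)} t⁻³` (the integrand is positive on the open, non-empty,
finite-volume solid; in particular the Bochner integral is not a junk `0`).
[cite: Milnor1982, Appendix, Lemma 2] -/
theorem idealTetrahedronVolume_pos {z : ℂ} (him : 0 < z.im) : 0 < idealTetrahedronVolume z := by
  unfold idealTetrahedronVolume
  have hopen := isOpen_idealTetrahedron z
  rw [setIntegral_pos_iff_support_of_nonneg_ae]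
  · have hsub : idealTetrahedron z ⊆
        Function.support (fun p : Fin 3 → ℝ => 1 / p 2 ^ 3) ∩ idealTetrahedron z :=
      fun p hp => ⟨by simpa using (pow_pos hp.2.2.2.1 3).ne', hp⟩
    exact (hopen.measure_pos volume (nonempty_idealTetrahedron him)).trans_le
      (measure_mono hsub)
  · rw [Filter.EventuallyLE, ae_restrict_iff' (measurableSet_idealTetrahedron z)]
    exact Filter.Eventually.of_forall fun p hp => by
      simpa using (pow_pos hp.2.2.2.1 3).le
  · exact integrableOn_one_div_cube_idealTetrahedron him

namespace KZ

/-! ### The integral representation -/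

/-- **The ideal tetrahedron as a KZ integral representation.** For `z` algebraic over `ℚ` with
`Im z > 0`, `[T(∞, 0, 1, z), t⁻³]`: domain `idealTetrahedron z` (`ℚ`-semialgebraic since
`Re z`, `Im z` are real algebraic), integrand the hyperbolic volume density `p ↦ 1 / p 2 ^ 3` of the
upper half-space model (a `ℚ`-rational function), absolutely convergent
(`integrableOn_one_div_cube_idealTetrahedron`). Its value is `idealTetrahedronVolume z`, the
hyperbolic volume of the ideal tetrahedron with vertices `∞, 0, 1, z`, i.e. the Bloch–Wigner
dilogarithm `D(z)` (Milnor 1982, Lemma 2; Zagier 1986, p. 299) — an identification not formalised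
here. [cite: Milnor1982, Appendix, Lemma 2] -/
def idealTetrahedronRep (z : ℂ) (hz : IsAlgebraic ℚ z) (him : 0 < z.im) : IntegralRep 3 where
  domain := idealTetrahedron z
  integrand p := 1 / p 2 ^ 3
  isSemialgebraic_domain :=
    isSemialgebraic_idealTetrahedron (isAlgebraic_re_im hz).1 (isAlgebraic_re_im hz).2
  isSemialgebraicFunOn_integrand :=
    isSemialgebraicFunOn_one_div_cube
      (isSemialgebraic_idealTetrahedron (isAlgebraic_re_im hz).1 (isAlgebraic_re_im hz).2)
      (fun _ hp => pos_of_mem_idealTetrahedron hp)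
  integrableOn := integrableOn_one_div_cube_idealTetrahedron him

/-- The domain of `idealTetrahedronRep z` is the solid ideal tetrahedron `T(∞, 0, 1, z)`.
[cite: Milnor1982, Appendix, Lemma 2] -/
@[simp] theorem domain_idealTetrahedronRep (z : ℂ) (hz : IsAlgebraic ℚ z) (him : 0 < z.im) :
    (idealTetrahedronRep z hz him).domain = idealTetrahedron z := rfl

/-- The integrand of `idealTetrahedronRep z` is the hyperbolic volume density `t⁻³`.
[cite: Milnor1982, Appendix, Lemma 2 (proof)] -/
@[simp] theorem integrand_idealTetrahedronRep (z : ℂ) (hz : IsAlgebraic ℚ z) (him : 0 < z.im) :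
    (idealTetrahedronRep z hz him).integrand = fun p => 1 / p 2 ^ 3 := rfl

/-- `idealTetrahedronRep z` has KZ's literal rational shape: integrand `1 / X₂³`.
[cite: KontsevichZagier2001, §1.1] -/
theorem isRational_idealTetrahedronRep (z : ℂ) (hz : IsAlgebraic ℚ z) (him : 0 < z.im) :
    (idealTetrahedronRep z hz him).IsRational :=
  ⟨1, X 2 ^ 3, fun p hp => by simpa using pow_ne_zero 3 (ne_of_gt (α := ℝ) hp.2.2.2.1),
    fun p _ => by simp [idealTetrahedronRep]⟩

/-- The number represented by `idealTetrahedronRep z` is `idealTetrahedronVolume z`, the hyperbolic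
volume `∫_{T(∞,0,1,z)} dx dy dt / t³` of the ideal tetrahedron (`= D(z)`, Milnor; not proved here).
[cite: Milnor1982, Appendix, Lemma 2] -/
theorem value_idealTetrahedronRep (z : ℂ) (hz : IsAlgebraic ℚ z) (him : 0 < z.im) :
    (idealTetrahedronRep z hz him).value = idealTetrahedronVolume z := rfl

/-- The value of `idealTetrahedronRep z`, unfolded to the set integral.
[cite: Milnor1982, Appendix, Lemma 2] -/
theorem value_idealTetrahedronRep_eq_integral (z : ℂ) (hz : IsAlgebraic ℚ z) (him : 0 < z.im) :
    (idealTetrahedronRep z hz him).value = ∫ p in idealTetrahedron z, 1 / p 2 ^ 3 := rfl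

/-- The hyperbolic volume represented by `idealTetrahedronRep z` is positive.
[cite: Milnor1982, Appendix, Lemma 2] -/
theorem value_idealTetrahedronRep_pos (z : ℂ) (hz : IsAlgebraic ℚ z) (him : 0 < z.im) :
    0 < (idealTetrahedronRep z hz him).value :=
  idealTetrahedronVolume_pos him

end KZ

end Literature.NumberTheory.Transcendental
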